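import Literature.AlgebraicGeometry.Motives.ProperIntegralPoints
import Literature.AlgebraicGeometry.Motives.BaseChange
import HarnessLib

/-!
# Integral points of a proper scheme: naturality across two base points, and the points of a base-twisted model

Topic `Literature/AlgebraicGeometry/Motives`; THEOREMS ONLY (no definition, no named fact, no instance; net Literature debt 0).
Sequel of `ProperIntegralPoints` (extension `extendPoint` / reduction `reducePointMonoidHom` of points of a proper `O`-scheme
along a valuation ring `R ⊆ Ω`, [Hartshorne1977] II.4.7).  Cell `hodgecm-mathlib` (D-0151), programme E4, piece Q5-P2 of the
scoping memo `SCOPE-E4-Q5-twistedReduction` («semilinear base naturality»): the model-level core of [Shimura1998] §18.6 p. 127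
«`(Y^σ)~ = Ỹ^f` for every object `Y` rational over `L`» — the reduction map of the CONJUGATE model `𝒳 ⊗_{𝓞_v, γᵥ} 𝓞_v`
(`GoodReductionAt.conjModel`) versus the reduction map of `𝒳` translated by an automorphism `σ` of the valuation ring lying
over `γᵥ`.

* §1 `extendPoint_naturality₂`, `reducePointMonoidHom_naturality₂` — extension / reduction of points are natural along an
  `O`-morphism `τ : Spec (R₁, f₁) → Spec (R₂, f₂)` between TWO base points (different rings or structure maps); the tree's
  `extendPoint_naturality` / `reducePointMonoidHom_naturality` are the case of one base point; `specMap_comp_specMap_eq_of_comp_eq`: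
  `Spec σ` for `σ : R₁ → R₂` over `φ : O → O` (`σ ∘ f₁ = f₂ ∘ φ`) is such a `τ` from the `φ`-TWISTED base point `(R₂, f₂ ∘ φ)`.
* §2 `twistPoint_w(')`, `extendPoint_twist_left`, `reducePointMonoidHom_twist_left` — points of the twisted model
  `𝒳 ⊗_{O,φ} O = (baseChangeHom φ).obj 𝒳` with values in `(R, f)` are points of `𝒳` with values in `(R, f ∘ φ)` (project by
  `pr₁ = baseChangeHomFst φ 𝒳`), compatibly with extension and reduction (uniqueness).  All equations are on underlying
  morphisms of the concrete schemes `Spec k`, so base points with different structure maps never meet in one unification.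

HC_CM is proved only modulo the 7 printed citations until rung 0 closes.
-/

set_option autoImplicit false

-- Compositions through `((baseChangeHom φ).obj X).left = pullback X.hom (Spec φ)` and `(specRingHomOver R f g).left = Spec k`
-- are definitional only above `instances` transparency (cf. `AbelianVarietyGoodReductionConjugate`).
set_option backward.isDefEq.respectTransparency false

noncomputable section

open CategoryTheory CategoryTheory.Limits AlgebraicGeometry
open scoped MonObj CategoryTheory.Obj

universe u

namespace Literature.AlgebraicGeometry.Motives

/-! ### §1. Extension and reduction of points are natural across two base points `(R₁, f₁) → (R₂, f₂)` -/

section TwoBases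

variable {O : Type u} [CommRing O] {Ω₁ Ω₂ : Type u} [Field Ω₁] [Field Ω₂] (R₁ : ValuationSubring Ω₁)
  (R₂ : ValuationSubring Ω₂) (f₁ : O →+* R₁) (f₂ : O →+* R₂) (𝒳 : SchemeOver O)

/-- **Uniqueness makes extension natural across base points**: for an `O`-morphism `τ : Spec R₁ → Spec R₂` between two
valuation-ring base points of `Spec O` (possibly different rings and different structure maps) with a compatible
`τ' : Spec Ω₁ → Spec Ω₂` on generic points, and an `Ω₂`-point `P` of a proper `O`-scheme `𝒳`:
`extend (τ' ≫ P) = τ ≫ extend P`.  The tree's `extendPoint_naturality` is the case `(R₁, f₁) = (R₂, f₂)`.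
[cite: Hartshorne1977, II.4.7] -/
theorem extendPoint_naturality₂ [IsProper 𝒳.hom] (τ : specValuationSubring R₁ f₁ ⟶ specValuationSubring R₂ f₂)
    (τ' : specFractionField R₁ f₁ ⟶ specFractionField R₂ f₂)
    (hτ : τ' ≫ specFractionFieldι R₂ f₂ = specFractionFieldι R₁ f₁ ≫ τ) (P : specFractionField R₂ f₂ ⟶ 𝒳) :
    extendPoint R₁ f₁ 𝒳 (τ' ≫ P) = τ ≫ extendPoint R₂ f₂ 𝒳 P := by
  rw [extendPoint_eq_iff]
  change specFractionFieldι R₁ f₁ ≫ τ ≫ extendPoint R₂ f₂ 𝒳 P = τ' ≫ P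
  rw [← Category.assoc, ← hτ, Category.assoc]
  congr 1
  exact restrictPoint_extendPoint R₂ f₂ 𝒳 P

/-- **The reduction map is natural across base points**: with moreover compatible morphisms `τk : Spec k₁ → Spec k₂` on the
special points (`τk ≫ ι₂ = ι₁ ≫ τ`), `red₁ (τ' ≫ P) = τk ≫ red₂ P` for a proper `O`-group scheme `𝒳`.  The tree's
`reducePointMonoidHom_naturality` is the case of ONE base point and a compatible triple `(σ, σΩ, σk)` of ring endomorphisms
OVER `O`; here the two base points may differ (e.g. `f₂ = f₁ ∘ φ` twisted by an automorphism `φ` of `O`, `τ = Spec σ` for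
`σ : R → R` over `φ`). [cite: Hartshorne1977, II.4.7] -/
theorem reducePointMonoidHom_naturality₂ [GrpObj 𝒳] [IsProper 𝒳.hom] {k₁ k₂ : Type u} [CommRing k₁] [CommRing k₂]
    (g₁ : R₁ →+* k₁) (g₂ : R₂ →+* k₂) (τ : specValuationSubring R₁ f₁ ⟶ specValuationSubring R₂ f₂)
    (τ' : specFractionField R₁ f₁ ⟶ specFractionField R₂ f₂)
    (hτ : τ' ≫ specFractionFieldι R₂ f₂ = specFractionFieldι R₁ f₁ ≫ τ)
    (τk : specRingHomOver R₁ f₁ g₁ ⟶ specRingHomOver R₂ f₂ g₂)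
    (hk : τk ≫ specRingHomι R₂ f₂ g₂ = specRingHomι R₁ f₁ g₁ ≫ τ) (P : specFractionField R₂ f₂ ⟶ 𝒳) :
    reducePointMonoidHom R₁ f₁ 𝒳 g₁ (τ' ≫ P) = τk ≫ reducePointMonoidHom R₂ f₂ 𝒳 g₂ P := by
  rw [reducePointMonoidHom_apply, reducePointMonoidHom_apply, extendPoint_naturality₂ R₁ R₂ f₁ f₂ 𝒳 τ τ' hτ P,
    ← Category.assoc, ← hk, Category.assoc]

/-- The case of a ring map `σ : R₁ → R₂` lying OVER a ring endomorphism `φ` of `O` (`σ ∘ f₁ = f₂ ∘ φ`): `Spec σ` is an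
`O`-morphism from the `φ`-TWISTED base point `Spec (R₂, f₂ ∘ φ)` to the base point `Spec (R₁, f₁)` — the commuting condition
for `Over.homMk (Spec.map (CommRingCat.ofHom σ))`. [cite: Hartshorne1977, II.4.7] -/
theorem specMap_comp_specMap_eq_of_comp_eq {R₁' R₂' : Type u} [CommRing R₁'] [CommRing R₂'] (f₁' : O →+* R₁')
    (f₂' : O →+* R₂') (φ : O →+* O) (σ : R₁' →+* R₂') (hσ : σ.comp f₁' = f₂'.comp φ) :
    Spec.map (CommRingCat.ofHom σ) ≫ Spec.map (CommRingCat.ofHom f₁') = Spec.map (CommRingCat.ofHom (f₂'.comp φ)) := by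
  rw [← Spec.map_comp, ← CommRingCat.ofHom_comp, hσ]

end TwoBases

/-! ### §2. Points of the base-twisted model `𝒳 ⊗_{O, φ} O` are points of `𝒳` for the twisted structure map `f ∘ φ` -/

section Twist

variable {O : Type u} [CommRing O] {Ω : Type u} [Field Ω] (R : ValuationSubring Ω) (f : O →+* R) (φ : O →+* O)
  (𝒳 : SchemeOver O)

/-- `Spec (f ∘ φ) = Spec f ≫ Spec φ`. [folklore] -/
private theorem specMap_ofHom_comp' {S : Type u} [CommRing S] (f' : O →+* S) :
    Spec.map (CommRingCat.ofHom (f'.comp φ)) = Spec.map (CommRingCat.ofHom f') ≫ Spec.map (CommRingCat.ofHom φ) := by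
  rw [CommRingCat.ofHom_comp, Spec.map_comp]

/-- The cartesian square of the twisted model: `pr₁ ≫ (𝒳 → Spec O) = (𝒳 ⊗_{O,φ} O → Spec O) ≫ Spec φ`. [folklore] -/
private theorem baseChangeHomFst_comp_hom' :
    baseChangeHomFst φ 𝒳 ≫ 𝒳.hom = ((baseChangeHom φ).obj 𝒳).hom ≫ Spec.map (CommRingCat.ofHom φ) :=
  pullback.condition

/-- **A point of the twisted model is a point of the model for the twisted structure map**: an `O`-morphism
`P : Spec (R, f, g) → 𝒳 ⊗_{O,φ} O` (the model base-changed along `Spec φ`, the tree's `baseChangeHom φ` = Mathlib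
`Over.pullback`) followed by the projection `pr₁ = baseChangeHomFst φ 𝒳` is an `O`-morphism `Spec (R, f ∘ φ, g) → 𝒳` (same
underlying scheme `Spec k`, structure map twisted by `φ`): the commuting condition for `Over.homMk`.  Serre–Tate's conjugate
model `𝒳 ⊗_{𝓞_v, γᵥ} 𝓞_v` ([Shimura1998] §18.6 p. 127; the tree's `GoodReductionAt.conjModel`) is the case `φ = γᵥ`.
(All underlying maps are typed on the concrete schemes `Spec k`, so that base points with different structure maps never meet
in one unification problem.) [cite: GortzWedhorn2020, Section (4.7)] -/
theorem twistPoint_w {k : Type u} [CommRing k] (g : R →+* k) (P : specRingHomOver R f g ⟶ (baseChangeHom φ).obj 𝒳) :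
    ((P.left ≫ baseChangeHomFst φ 𝒳) ≫ 𝒳.hom : Spec (.of k) ⟶ Spec (.of O)) =
      Spec.map (CommRingCat.ofHom g) ≫ Spec.map (CommRingCat.ofHom (f.comp φ)) := by
  have hw : (P.left ≫ ((baseChangeHom φ).obj 𝒳).hom : Spec (.of k) ⟶ Spec (.of O)) =
      Spec.map (CommRingCat.ofHom g) ≫ Spec.map (CommRingCat.ofHom f) := Over.w P
  calc ((P.left ≫ baseChangeHomFst φ 𝒳) ≫ 𝒳.hom : Spec (.of k) ⟶ Spec (.of O))
      = P.left ≫ baseChangeHomFst φ 𝒳 ≫ 𝒳.hom := Category.assoc _ _ _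
    _ = P.left ≫ ((baseChangeHom φ).obj 𝒳).hom ≫ Spec.map (CommRingCat.ofHom φ) :=
        congrArg (P.left ≫ ·) (baseChangeHomFst_comp_hom' φ 𝒳)
    _ = (P.left ≫ ((baseChangeHom φ).obj 𝒳).hom) ≫ Spec.map (CommRingCat.ofHom φ) := (Category.assoc _ _ _).symm
    _ = (Spec.map (CommRingCat.ofHom g) ≫ Spec.map (CommRingCat.ofHom f)) ≫ Spec.map (CommRingCat.ofHom φ) :=
        congrArg (· ≫ Spec.map (CommRingCat.ofHom φ)) hw
    _ = Spec.map (CommRingCat.ofHom g) ≫ Spec.map (CommRingCat.ofHom (f.comp φ)) := by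
        rw [specMap_ofHom_comp', Category.assoc]

/-- The same for the valuation-ring base point `Spec (R, f)` itself. [cite: GortzWedhorn2020, Section (4.7)] -/
theorem twistPoint_w' (l : specValuationSubring R f ⟶ (baseChangeHom φ).obj 𝒳) :
    ((l.left ≫ baseChangeHomFst φ 𝒳) ≫ 𝒳.hom : Spec (.of R) ⟶ Spec (.of O)) = Spec.map (CommRingCat.ofHom (f.comp φ)) := by
  have hw : (l.left ≫ ((baseChangeHom φ).obj 𝒳).hom : Spec (.of R) ⟶ Spec (.of O)) =
      Spec.map (CommRingCat.ofHom f) := Over.w l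
  calc ((l.left ≫ baseChangeHomFst φ 𝒳) ≫ 𝒳.hom : Spec (.of R) ⟶ Spec (.of O))
      = l.left ≫ baseChangeHomFst φ 𝒳 ≫ 𝒳.hom := Category.assoc _ _ _
    _ = l.left ≫ ((baseChangeHom φ).obj 𝒳).hom ≫ Spec.map (CommRingCat.ofHom φ) :=
        congrArg (l.left ≫ ·) (baseChangeHomFst_comp_hom' φ 𝒳)
    _ = (l.left ≫ ((baseChangeHom φ).obj 𝒳).hom) ≫ Spec.map (CommRingCat.ofHom φ) := (Category.assoc _ _ _).symm
    _ = Spec.map (CommRingCat.ofHom f) ≫ Spec.map (CommRingCat.ofHom φ) :=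
        congrArg (· ≫ Spec.map (CommRingCat.ofHom φ)) hw
    _ = Spec.map (CommRingCat.ofHom (f.comp φ)) := (specMap_ofHom_comp' φ f).symm

/-- **Extension of points commutes with the twist** (on underlying schemes): if `P` is an `Ω`-point of the twisted model
`𝒳 ⊗_{O,φ} O` for the base point `(R, f)` and `P'` the corresponding `Ω`-point of `𝒳` for the twisted base point `(R, f ∘ φ)`
(`P'.left = P.left ≫ pr₁`), then the extension of `P'` to `Spec R` is the extension of `P` followed by `pr₁` (uniqueness of
extensions, [Hartshorne1977] II.4.7; both models proper). [cite: Hartshorne1977, II.4.7] -/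
theorem extendPoint_twist_left [IsProper 𝒳.hom] [IsProper ((baseChangeHom φ).obj 𝒳).hom]
    (P : specFractionField R f ⟶ (baseChangeHom φ).obj 𝒳) (P' : specFractionField R (f.comp φ) ⟶ 𝒳)
    (hP : (P'.left : Spec (.of Ω) ⟶ 𝒳.left) = P.left ≫ baseChangeHomFst φ 𝒳) :
    ((extendPoint R (f.comp φ) 𝒳 P').left : Spec (.of R) ⟶ 𝒳.left) =
      (extendPoint R f ((baseChangeHom φ).obj 𝒳) P).left ≫ baseChangeHomFst φ 𝒳 := by
  -- the candidate extension of `P'`: the extension of `P`, projected to `𝒳`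
  have hE' : extendPoint R (f.comp φ) 𝒳 P' =
      Over.homMk (U := specValuationSubring R (f.comp φ)) (V := 𝒳)
        ((extendPoint R f ((baseChangeHom φ).obj 𝒳) P).left ≫ baseChangeHomFst φ 𝒳 : Spec (.of R) ⟶ 𝒳.left)
        (twistPoint_w' R f φ 𝒳 _) := by
    rw [extendPoint_eq_iff]
    ext : 1
    change (Spec.map (CommRingCat.ofHom (algebraMap R Ω)) ≫
        (extendPoint R f ((baseChangeHom φ).obj 𝒳) P).left ≫ baseChangeHomFst φ 𝒳 : Spec (.of Ω) ⟶ 𝒳.left) = P'.left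
    rw [hP, ← Category.assoc]
    exact congrArg (· ≫ baseChangeHomFst φ 𝒳) (congrArg CommaMorphism.left (restrictPoint_extendPoint R f _ P))
  rw [hE']
  rfl

/-- **Reduction of points commutes with the twist** (on underlying schemes): for a proper `O`-group scheme `𝒳`, an
`Ω`-point `P` of the twisted model for `(R, f)` and the corresponding point `P'` of `𝒳` for `(R, f ∘ φ)`, the reduction of
`P'` along `g : R → k` is the reduction of `P` followed by `pr₁`.  Combined with §1 (`τ = Spec σ` for `σ : R → R` over `φ`) this
reads: the reduction map of the twisted model is the `σ`-translate of the reduction map of the model — the model-level core of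
«`(Y^σ)~ = Ỹ^f`» ([Shimura1998] §18.6 p. 127). [cite: Hartshorne1977, II.4.7] [cite: Shimura1998, §18.6 proof of Thm. 18.6 (reduction modulo `𝔓`, «(Y^σ)~ = Ỹ^f»), p. 127] -/
theorem reducePointMonoidHom_twist_left [GrpObj 𝒳] [GrpObj ((baseChangeHom φ).obj 𝒳)] [IsProper 𝒳.hom]
    [IsProper ((baseChangeHom φ).obj 𝒳).hom] {k : Type u} [CommRing k] (g : R →+* k)
    (P : specFractionField R f ⟶ (baseChangeHom φ).obj 𝒳) (P' : specFractionField R (f.comp φ) ⟶ 𝒳)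
    (hP : (P'.left : Spec (.of Ω) ⟶ 𝒳.left) = P.left ≫ baseChangeHomFst φ 𝒳) :
    ((reducePointMonoidHom R (f.comp φ) 𝒳 g P').left : Spec (.of k) ⟶ 𝒳.left) =
      (reducePointMonoidHom R f ((baseChangeHom φ).obj 𝒳) g P).left ≫ baseChangeHomFst φ 𝒳 := by
  have h := extendPoint_twist_left R f φ 𝒳 P P' hP
  rw [reducePointMonoidHom_apply, reducePointMonoidHom_apply]
  change (Spec.map (CommRingCat.ofHom g) ≫ (extendPoint R (f.comp φ) 𝒳 P').left : Spec (.of k) ⟶ 𝒳.left) =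
    (Spec.map (CommRingCat.ofHom g) ≫ (extendPoint R f ((baseChangeHom φ).obj 𝒳) P).left) ≫ baseChangeHomFst φ 𝒳
  exact (congrArg (Spec.map (CommRingCat.ofHom g) ≫ ·) h).trans (Category.assoc _ _ _).symm

end Twist

end Literature.AlgebraicGeometry.Motives

end
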